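import Summits.QuantumFields.YangMills.Theorems.BalabanUVNodesN15KingModelToronGauge
import Summits.QuantumFields.YangMills.Theorems.BalabanUVNodesN15KingModelToronMasslessResolvent
import Summits.QuantumFields.YangMills.Theorems.BalabanUVNodesN15KingModelToronImages
import Summits.QuantumFields.YangMills.Theorems.BalabanUVNodesN15KingModelToronHeatKernel
import Summits.QuantumFields.YangMills.Theorems.BalabanUVNodesN15KingModelToronCartan
import HarnessLib

/-!
# BalabanUVNodes ∕ N15 — THE KING-MODEL RUNG (PART Ͷ-h): PART Ͷ BY NAME — KING's FINE COVARIANCE AT A FLAT CONNECTION WITH HOLONOMY (TORONS), IN THREE CONJUNCTIONS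
# (Track A, DAG node N15 = NE2; FAN-OUT v1.1 §N15 s3 «KING-MODEL RUNG … + what the curved case adds»; count-neutral)

HONEST FRAMING.  Count-neutral (cell `pub-ymgap`, seat `pub-ymgap-dag-n15-e` g44; `--supports stmt-QuantumFields-27247 --as helper` = K3ᴬ, KEY MAP v3).  One finite torus
`T = Π_μℤ∕K_μ` at fixed spacing; King's `A = 0` model [King1986] is the comparison object; constant abelian (`U(1)`) link fields — FLAT connections, one gauge class per holonomy
vector `(e^{iθ_μ})_μ ∈ U(1)^{d+1}`; the tree's B5 toron twins ([Balaban1984PropagatorsI] (1.31), [Balaban1985BackgroundPropagators] (3.3)∕(3.23) at a constant abelian background) and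
`FlatLatticeGaugeFields` (['t Hooft, NPB 153 (1979)] twisted boundary conditions) are the vocabulary.  This file only CONJOINS the theorems of PARTS Ͷ-a…Ͷ-g by name.
NOT Bałaban's `G_k(U)` (no averaging penalty), NOT [Balaban1985BackgroundPropagators] (3.42); NOT a node discharge (N15 of record untouched); nothing continuum ∕ ℝ⁴ ∕ OS ∕ Clay.

* ★★★ `king_toron_package` (massive, every unit `ω = e^{iφ}`, `c ≥ 0`, `m² > 0`): (1) the dictionary `M_ω = m²·1 + LapSTw K (√c) ω`; (2) the covariance in twisted plane waves; (3) the
  twisted image sum over PART Ε's free lattice kernel; (4) Kato at the toron (by the image sum); (5) the two shifted-grid inequalities (`Σ_q lapSymTw⁻¹ ≤ Σ_q lapSym⁻¹`,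
  `Π_q lapSym ≤ Π_q lapSymTw`); (6) the diamagnetic heat trace for every `t ≥ 0`; (7) gauge classes = holonomies.
* ★★★ `king_toron_gap_package` (reduced holonomy angles `|θ_μ| ≤ π`, `c > 0`): (1) coercivity at `m² + holonomyGap(θ)` and (2) equality on the constants; (3) Jordan bounds;
  (4) the η-rate `|holonomyGap − cΣ(θ_μ∕K_μ)²| ≤ (5∕48)cΣ(θ_μ∕K_μ)⁴`; (5) positive definite iff `θ ≠ 0` iff not a pure gauge; (6) for `θ ≠ 0` the massless covariance exists with
  `‖(−cΔ_ω)⁻¹‖_{ℓ²→ℓ²} = 1∕holonomyGap(θ)`.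
* ★★ `king_cartan_toron_package` (fibre `ℂⁿ`, maximal-torus constant link field): colour splitting, covariance colour by colour, determinant, the smallest colour gap.

PRIOR TREE ART: PARTS Ͷ-a (`toronOp_eq_LapSTw`), Ͷ-b (`toronOp_inv_apply_eq`, `sum_inv_lapSymTw_le_sum_inv_lapSym`, `prod_lapSym_le_prod_lapSymTw`), Ͷ-c (`toronLink_gaugeEquiv_iff`), Ͷ-d
(`form_toronOp_ge_holonomyGap`, `form_toronOp_one`, `holonomyGap_ge_sq`, `holonomyGap_le_sq`, `abs_holonomyGap_sub_continuum_le`, `toronOp_massless_posDef_iff`, `toronLink_pureGauge_iff`), Ͷ-e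
(`isUnit_toronOp_massless`, `l2_opNorm_toronOp_massless_inv_eq`), Ͷ-f (`toronOp_inv_apply_eq_twistedImages`, `norm_toronOp_inv_le_tsum_freeKer`), Ͷ-g (`sum_exp_neg_lapSymTw_le`), Ͷ-i (`covLapF_cartanLink_eq_blockDiagonal`, `covLapF_cartanLink_inv`,
`det_covLapF_cartanLink_eq_prod`, `form_covLapF_cartanLink_ge`).  Dedup (rg at
filing): basename 0 files; needles `king_toron_package|king_toron_gap_package|king_cartan_toron_package` 0 tree files.  Locators: [King1986] (4.4) p.670, (4.35) p.674, (4.7)–(4.10) p.671, (3.89) p.668;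
[Balaban1985BackgroundPropagators] (3.3) p.391, (3.23) p.394, p.398 l.19; [Balaban1984PropagatorsI] (1.29)∕(1.31) p.23, p.36 l.20–23; [DodziukMathai2006] §1 Cor 1.3, Thm 1.5;
[tHooft1979Flux] NPB 153 (notion only).  0 `sorry`, 0 `def`.
-/

noncomputable section

open scoped BigOperators ComplexConjugate ComplexOrder Matrix.Norms.L2Operator
open Finset Matrix Complex

namespace Summit.QuantumFields.YangMills.BalabanUVNodes.N15KingModelRung.Toron

open Literature.MathematicalPhysics.QuantumFieldTheory.LatticeDiamagneticInequality (Hopping)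
open Literature.MathematicalPhysics.QuantumFieldTheory.Balaban1983to89.B5Prop11Plancherel
open Literature.MathematicalPhysics.QuantumFieldTheory.Balaban1983to89.B4TorusKernel.MultiPeriod (translate)
open Literature.MathematicalPhysics.QuantumFieldTheory.Balaban1983to89.B5ToronOperators118 (LapSTw)
open Literature.MathematicalPhysics.QuantumFieldTheory.Balaban1983to89.B5ToronMomentum161 (twistOf)
open Literature.MathematicalPhysics.QuantumFieldTheory.King1986.Torus (lapF lapSym)
open Summit.QuantumFields.YangMills.BalabanUVNodes.N15KingModelRung.Covariant (covLapF kingGaugeAct)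
open Summit.QuantumFields.YangMills.BalabanUVNodes.N15KingModelRung.TorusSpectral (freeKerC freeKer torRepZ)

variable {d : ℕ} (K : Fin (d + 1) → ℕ) [hK : ∀ μ, NeZero (K μ)] {c m2 : ℝ}

/-- ★★★ **PART Ͷ BY NAME, I — KING's FINE COVARIANCE AT A TORON** (every period vector, `c ≥ 0`, `m² > 0`, every phase vector `φ`, `ω = e^{iφ}`, `M = toronOp K c m² ω`):
(1) `M = m²·1 + LapSTw K (√c) ω` (the tree's B5 toron twin); (2) `M⁻¹(x,y) = |T|⁻¹Σ_q lapSymTw(φ,q)⁻¹e^{iq·(x−y)}`;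
(3) `M⁻¹(x,y) = conj(ω^{x̃})·ω^{ỹ}·Σ'_n conj(Π_μ(ω_μ^{K_μ})^{n_μ})·K_∞(x̃ − ỹ + Kn)` (holonomy-twisted periodisation of King's free lattice kernel); (4) `|M⁻¹(x,y)| ≤ (lapF K c m²)⁻¹(x,y)`;
(5) `Σ_q lapSymTw(φ,q)⁻¹ ≤ Σ_q lapSym(q)⁻¹` and `Π_q lapSym(q) ≤ Π_q lapSymTw(φ,q)`; (6) `Σ_q e^{−t·lapSymTw(φ,q)} ≤ Σ_q e^{−t·lapSym(q)}` for every `t ≥ 0`;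
(7) for unit `ω′`, `ω′` is a gauge transform of `ω` iff `ω′_μ^{K_μ} = ω_μ^{K_μ}` for all `μ`.
[cite: King1986, (4.4) p.670, (4.35) p.674, (3.89) p.668; Balaban1984PropagatorsI, (1.31) p.23, p.36 l.20–23; Balaban1985BackgroundPropagators, (3.23) p.394, p.398 l.19; DodziukMathai2006, Thm 1.5 §1] -/
theorem king_toron_package (hc : 0 ≤ c) (hm : 0 < m2) (φ : Fin (d + 1) → ℝ) :
    toronOp K c m2 (twistOf φ) = (m2 : ℂ) • (1 : Matrix (Tor K) (Tor K) ℂ) + LapSTw K ((Real.sqrt c : ℝ) : ℂ) (twistOf φ)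
    ∧ (∀ x y, (toronOp K c m2 (twistOf φ))⁻¹ x y = (Fintype.card (Tor K) : ℂ)⁻¹ * ∑ q : Tor K, (((lapSymTw K c m2 φ q)⁻¹ : ℝ) : ℂ) * chi K q (x - y))
    ∧ (∀ x y, (toronOp K c m2 (twistOf φ))⁻¹ x y
        = conj (locPhase (twistOf φ) (torRepZ K x)) * locPhase (twistOf φ) (torRepZ K y)
          * ∑' n : Fin (d + 1) → ℤ, conj (holChar K (twistOf φ) n) * freeKerC c m2 (translate K (torRepZ K x - torRepZ K y) n))
    ∧ (∀ x y, ‖(toronOp K c m2 (twistOf φ))⁻¹ x y‖ ≤ (lapF K c m2)⁻¹ x y)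
    ∧ ((∑ q : Tor K, (lapSymTw K c m2 φ q)⁻¹ ≤ ∑ q : Tor K, (lapSym K c m2 q)⁻¹) ∧ (∏ q : Tor K, lapSym K c m2 q ≤ ∏ q : Tor K, lapSymTw K c m2 φ q))
    ∧ (∀ t : ℝ, 0 ≤ t → ∑ q : Tor K, Real.exp (-(t * lapSymTw K c m2 φ q)) ≤ ∑ q : Tor K, Real.exp (-(t * lapSym K c m2 q)))
    ∧ (∀ ω' : Fin (d + 1) → ℂ, (∀ μ, ‖ω' μ‖ = 1) →
        ((∃ g : Tor K → Matrix Unit Unit ℂ, (∀ x, g x ∈ Matrix.unitaryGroup Unit ℂ) ∧ toronLink K ω' = kingGaugeAct K g (toronLink K (twistOf φ)))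
          ↔ ∀ μ, toronHol K ω' μ = toronHol K (twistOf φ) μ)) := by
  refine ⟨toronOp_eq_LapSTw K hc m2 (norm_twistOf_eq_one φ), fun x y => ?_, fun x y => toronOp_inv_apply_eq_twistedImages K hc hm (norm_twistOf_eq_one φ) x y,
    fun x y => norm_toronOp_inv_le_tsum_freeKer K hc hm (norm_twistOf_eq_one φ) x y,
    ⟨sum_inv_lapSymTw_le_sum_inv_lapSym K hc hm φ, prod_lapSym_le_prod_lapSymTw K hc hm φ⟩, fun t ht => sum_exp_neg_lapSymTw_le K hc m2 ht φ,
    fun ω' hω' => toronLink_gaugeEquiv_iff K (norm_twistOf_eq_one φ) hω'⟩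
  rw [toronOp_inv_apply_eq K hc hm]; rfl

/-- ★★★ **PART Ͷ BY NAME, II — THE HOLONOMY GAP** (every period vector, `c > 0`, reduced holonomy angles `|θ_μ| ≤ π`, `ω = e^{iθ∕K}`, `M_{m²} = toronOp K c m² ω`):
(1) `(m² + holonomyGap)·Σ_x|v_x|² ≤ Re(v^*M_{m²}v)` for every `v` and every `m²`, with (2) equality for `v ≡ 1`; (3) `(4c∕π²)Σ_μ(θ_μ∕K_μ)² ≤ holonomyGap ≤ cΣ_μ(θ_μ∕K_μ)²`;
(4) `|holonomyGap − cΣ_μ(θ_μ∕K_μ)²| ≤ (5∕48)·cΣ_μ(θ_μ∕K_μ)⁴` when `|θ_μ| ≤ K_μ` (the η-rate, King (4.7)–(4.10)); (5) `M_0` is positive definite iff `θ ≠ 0` iff the toron is NOT a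
pure gauge; (6) for `θ ≠ 0`: `M_0` is invertible and `‖M_0⁻¹‖_{ℓ²→ℓ²} = holonomyGap⁻¹`.
[cite: King1986, (4.4) p.670, (4.35) p.674, (4.7)-(4.10) p.671; DodziukMathai2006, §1 Cor 1.3; Balaban1985BackgroundPropagators, (3.23) p.394; tHooft1979Flux, NPB 153 (twisted boundary conditions)] -/
theorem king_toron_gap_package (hc : 0 < c) {θ : Fin (d + 1) → ℝ} (hθ : ∀ μ, |θ μ| ≤ Real.pi) :
    (∀ (m2 : ℝ) (v : Tor K → ℂ), (m2 + holonomyGap K c θ) * ∑ x, ‖v x‖ ^ 2 ≤ (star v ⬝ᵥ (toronOp K c m2 (twistOf (redPhase K θ)) *ᵥ v)).re)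
    ∧ (∀ m2 : ℝ, (star (fun _ : Tor K => (1 : ℂ)) ⬝ᵥ (toronOp K c m2 (twistOf (redPhase K θ)) *ᵥ fun _ => (1 : ℂ))).re
        = (m2 + holonomyGap K c θ) * ∑ x : Tor K, ‖(fun _ : Tor K => (1 : ℂ)) x‖ ^ 2)
    ∧ (4 * c / Real.pi ^ 2 * ∑ μ, (θ μ / K μ) ^ 2 ≤ holonomyGap K c θ ∧ holonomyGap K c θ ≤ c * ∑ μ, (θ μ / K μ) ^ 2)
    ∧ ((∀ μ, |θ μ| ≤ K μ) → |holonomyGap K c θ - c * ∑ μ, (θ μ / K μ) ^ 2| ≤ 5 / 48 * c * ∑ μ, (θ μ / K μ) ^ 4)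
    ∧ (((toronOp K c 0 (twistOf (redPhase K θ))).PosDef ↔ θ ≠ 0)
        ∧ ((∃ g : Tor K → Matrix Unit Unit ℂ, (∀ x, g x ∈ Matrix.unitaryGroup Unit ℂ) ∧ toronLink K (twistOf (redPhase K θ)) = kingGaugeAct K g Hopping.free) ↔ θ = 0))
    ∧ (θ ≠ 0 → IsUnit (toronOp K c 0 (twistOf (redPhase K θ))) ∧ ‖(toronOp K c 0 (twistOf (redPhase K θ)))⁻¹‖ = (holonomyGap K c θ)⁻¹) :=
  ⟨fun m2 v => form_toronOp_ge_holonomyGap K hc.le m2 hθ v, fun m2 => form_toronOp_one K c m2 θ,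
    ⟨holonomyGap_ge_sq K hc.le hθ, holonomyGap_le_sq K hc.le θ⟩, fun hθK => abs_holonomyGap_sub_continuum_le K hc.le hθK,
    ⟨toronOp_massless_posDef_iff K hc hθ, toronLink_pureGauge_iff K hc hθ⟩,
    fun hne => ⟨isUnit_toronOp_massless K hc hθ hne, l2_opNorm_toronOp_massless_inv_eq K hc hθ hne⟩⟩

/-- ★★ **PART Ͷ BY NAME, III — CARTAN TORONS** (fibre `ℂⁿ`, colour phases `φ_i`, `U = diag(e^{iφ_i})`, every period vector, `c ≥ 0`): (1) `covLapF K c m² U = blockDiagonal(i ↦ toronOp K c m² (e^{iφ_i}))`;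
(2) for `m² > 0` the covariance is `blockDiagonal(i ↦ (toronOp (e^{iφ_i}))⁻¹)`; (3) `det = Π_iΠ_q lapSymTw(φ_i,q)`; (4) with reduced colour angles `θ_i` (`φ_i = θ_i∕K`) and any
`λ ≤ m² + holonomyGap(θ_i)` for every colour, `λ·Σ|v|² ≤ Re(v^*·covLapF·v)` — the gap is the smallest colour gap.
[cite: Balaban1985BackgroundPropagators, (3.23) p.394; Balaban1984PropagatorsI, (1.31) p.23; King1986, (3.89) p.668, (4.35) p.674] -/
theorem king_cartan_toron_package {n : Type*} [Fintype n] [DecidableEq n] (hc : 0 ≤ c) :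
    (∀ (m2 : ℝ) (φ : n → Fin (d + 1) → ℝ), covLapF K c m2 (cartanLink K fun i => twistOf (φ i)) = Matrix.blockDiagonal fun i => toronOp K c m2 (twistOf (φ i)))
    ∧ (∀ (m2 : ℝ) (φ : n → Fin (d + 1) → ℝ), 0 < m2 →
        (covLapF K c m2 (cartanLink K fun i => twistOf (φ i)))⁻¹ = Matrix.blockDiagonal fun i => (toronOp K c m2 (twistOf (φ i)))⁻¹)
    ∧ (∀ (m2 : ℝ) (φ : n → Fin (d + 1) → ℝ), (covLapF K c m2 (cartanLink K fun i => twistOf (φ i))).det = ((∏ i, ∏ q : Tor K, lapSymTw K c m2 (φ i) q : ℝ) : ℂ))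
    ∧ (∀ (m2 : ℝ) {θ : n → Fin (d + 1) → ℝ}, (∀ i μ, |θ i μ| ≤ Real.pi) → ∀ {lam : ℝ}, (∀ i, lam ≤ m2 + holonomyGap K c (θ i)) → ∀ v : Tor K × n → ℂ,
        lam * ∑ p, ‖v p‖ ^ 2 ≤ (star v ⬝ᵥ (covLapF K c m2 (cartanLink K fun i => twistOf (redPhase K (θ i))) *ᵥ v)).re) :=
  ⟨fun m2 _ => covLapF_cartanLink_eq_blockDiagonal K c m2 _, fun m2 φ hm => covLapF_cartanLink_inv K c m2 _ fun i => (toronOp_posDef K hc hm (norm_twistOf_eq_one (φ i))).isUnit,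
    fun m2 φ => det_covLapF_cartanLink_eq_prod K hc m2 φ, fun m2 _ hθ _ hlam v => form_covLapF_cartanLink_ge K hc m2 hθ hlam v⟩

end Summit.QuantumFields.YangMills.BalabanUVNodes.N15KingModelRung.Toron

end
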